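import Literature.MathematicalPhysics.QuantumFieldTheory.Balaban1983to89.B7Prop5General
import Literature.MathematicalPhysics.QuantumFieldTheory.Balaban1983to89.B7Prop4GeneralCk
import Literature.MathematicalPhysics.QuantumFieldTheory.Balaban1983to89.B7Prop5FlatOperator

/-!
# `Balaban1983to89.B7Ineq149Pairing` — T. Bałaban, *Averaging operations for lattice gauge theories*, Commun. Math. Phys. **98**
(1985) 17–51 [Balaban1985Averaging]: **(149)/(157) IN THE PRINTED PAIRING FORM AT A GENERAL REGULAR BACKGROUND** — «|⟨(δ/δA)C_j(U₀,
A), δA⟩| ≦ C₃|A|Q″_j|δA|» for a GENERAL variation `δA` of finitely many bond variables (not only a single-bond direction): the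
Fréchet derivative of `C_j(U₀, ·)(c)` on the variable space `𝔸^S` exists, is the sum of the per-bond columns of
`B7Prop5General.prop5_general_157`, and — with the count behind (141) — has operator norm `≤ 2d·C₃·(Lʲ)²b`

statement-level skeleton of published theorems with citation tags; proofs where landed; nothing here is a claim about the Yang–Mills mass gap

PDF held: `paper:balaban1985-cmp98-averaging` (journal page = PDF page + 16); pp. 39–42 [PDF 23–26] read from the materialised text
layer `~/.lit/texts/paper-balaban1985-cmp98-averaging/p0023.txt`–`p0026.txt`.

CITATION HEADER / WHAT IS REPRODUCED.  SKELETON rows **B7.Eq149** («(149)–(155)») and **B7.Prop5** ((157)) — cell `lit-balaban`, seat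
p06 gen 3 = unit `lit-balaban-p06`; owner r04, referee ref-4.  p. 39, verbatim: *"the differential … is a linear functional of the
variable δA and can be represented as a scalar product of δA and some Lie algebra valued function. This function is called the
functional derivative and is denoted by (δ/δA)F(A), thus we have (d/dt)F(A + tδA)|_{t=0} = Σ_{b⊂Ω} η^d tr (δF(A)/δA_b)δA_b =
⟨(δ/δA)F(A), δA⟩ (138)"*; (141): *"(Q″_kA)_c = Σ_{b⊂B^k(c₋)∪B^k(c₊)} η^dA_b"*; p. 40: *"We will prove by induction that
|⟨(δ/δA)C_j(U₀, A), δA⟩| ≦ C₃|A|Q″_j|δA|, (149) where the configurations A are considered on L^{−j}-lattice"*; p. 42: (157).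
`B7Prop5GeneralInduction.ineq149` / `B7Prop5General.prop5_general_157` render (149)/(157) PER BOND (`δA = X·δ_b`, DIVERGENCE (b)
of `B7Prop5Flat`: «pairing rendered per bond»); THIS FILE removes that divergence at a general background, in the finite-product
setting of `B7Prop5FlatOperator` (r20; flat background, the operator `Q_k(1, ·)`): on `𝔸^S` (any finite bond set `S`; print's
«A_b, b ⊂ Bʲ(c₋) ∪ Bʲ(c₊)» is `S ⊇` those bonds) the map `a ↦ C_j(U₀, ins_S a)(c)` is Fréchet differentiable (Prop. 4's
analyticity at a general background, `B7Prop6GeneralAnalytic.prop4_general_analyticAt`, and the continuous linear form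
`B7Prop4GeneralCk.clm_linCovIter_ins`, r04), its derivative is the LINEAR FUNCTIONAL of (137)–(138), and pairing it with a general
`δa ∈ 𝔸^S` gives the sum of the per-bond columns, hence (149).

DICTIONARY (as in `B7Prop5GeneralInduction` / `B7Prop5General`; every level rescaled to `ℤᵈ`): `C_j(U₀, B)(c)` ↦ `CCovIter L U₀ B j
z κ` (`c = (z, κ)`); the variables `B_s, s ∈ S` ↦ `a : S → 𝔸` inserted by `B7Prop3Flat.insCfg S a` (zero off `S`); `⟨(δ/δA)C_j,
δA⟩(c)` ↦ `fderiv ℂ (a ↦ C_j(ins_S a)(c)) a δa` (= `B7Ineq148.dPair`, (137)); `C₃|A|Q″_j|δA|(c)` ↦ `C3Gen d L·(Lʲ)²b·Σ_{s∈S} kerQdd L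
j z κ s‖δa s‖` (print's `A`, `δA` live on the `L^{−j}`-lattice, (149): `|A| = Lʲb`, `δA_s = Lʲδa_s`, `Q″_j|δA|(c) =
Σ_{s⊂Bʲ(c₋)∪Bʲ(c₊)} L^{−jd}|δA_s|` (141), `kerQdd = L^{−jd}·𝟙[s ⊂ Bʲ(c₋)∪Bʲ(c₊)]`; so `C₃|A|·Q″_j|δA|(c) = C₃·(Lʲ)²b·Σ_s kerQdd(c,
s)‖δa_s‖` — the column form of `B7Prop5GeneralInduction.ineq149` summed over `s ∈ S`); regime as in `B7Prop5General` (`pdev U₀ <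
α₀L^{−2k}`, `AvgClosed` structure group, `hsmall`, `hc₃`, `h145`, `h155`), on the closed polydisc `‖a_s‖ ≤ b`, `b > 0`.

WHAT THIS FILE PROVES (kernel, 0 sorry, standard axioms; theorems only): `sum_kerQdd_le` (the count behind (141)/(142): `Σ_{s∈S}
kerQdd(c, s) ≤ 2d`), `sum_kerQdd_mul_norm_le`; `hasFDerivAt_CCovIter_ins` (Fréchet differentiability of `C_j(U₀, ins_S ·)(c)` on the
polydisc, `j ≤ k`); `fderiv_CCovIter_ins_single` (its value on `X·e_s` is the per-bond column `dCov … (bump s X)` of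
`prop5_general_157`); **`ineq149_pairing`** = (149)/(157) in the printed pairing form `‖D[C_j(U₀, ins_S ·)(c)](a) δa‖ ≤
C₃·(Lʲ)²b·Σ_{s∈S} kerQdd(c, s)‖δa_s‖` for every `δa ∈ 𝔸^S`, every `j ≤ k`; `ineq149_pairing_dPair` (the same for `B7Ineq148.dPair`,
the displayed (137)); **`opNorm_fderiv_CCovIter_ins_le`**: `‖D[C_j(U₀, ins_S ·)(c)](a)‖ ≤ 2d·C₃·(Lʲ)²b` (sup norm on `𝔸^S`).
DIVERGENCES from print: as in `B7Prop5General` (explicit, non-optimal constants; `ℤᵈ`, corner blocks, `U1`/`AvgClosed`); the variation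
is supported in the chosen finite `S` (print: in `Bʲ(c₋) ∪ Bʲ(c₊)` — any `S` is allowed, `kerQdd` kills the bonds outside the box);
the operator bound uses the crude count `2d·L^{jd}` of `B7Prop5FlatOperator` (print states (149) with `Q″_j`, not an operator norm).
-/

noncomputable section

open scoped BigOperators
open NormedSpace Finset Metric

namespace Literature.MathematicalPhysics.QuantumFieldTheory.Balaban1983to89.B7Ineq149Pairing

open B7Prop1Explicit B7Prop1Local B7Prop2Explicit B7Prop3Flat B7Prop4Flat B7Eq92Concrete B7Prop3GeneralLinear
  B7Prop4GeneralLevels B7Ineq148 B7Prop5GeneralOperators B7Prop5GeneralLinear B7Prop5GeneralInduction B7Prop5GeneralLevels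
  B7Prop5General
open B7Prop5Flat (BondIn bump bondsIn mem_bondsIn boxFinset)
open B7Prop5FlatOperator (insCfg_line norm_insCfg_le_of_le card_bondsIn_le card_boxFinset_K)
open B7Prop6GeneralAnalytic (prop4_general_analyticAt)
open B7Prop4GeneralCk (clm_linCovIter_ins)

-- `Site` alone would resolve to the torus sites of `Setup.lean`; re-export the `ℤ^d` sites of `B7Prop1Explicit`.
export B7Prop1Explicit (Site)

variable {d : ℕ}

/-- `C₃ ≥ 0`. [folklore] -/
private theorem C3Gen_nonneg (d L : ℕ) : 0 ≤ C3Gen d L := by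
  unfold C3Gen C1ppGen; positivity

section Count

variable {𝔸 : Type*} [NormedRing 𝔸]

/-- **THE COUNT BEHIND (141)/(142)**: `Σ_{s∈S} kerQdd(c, s) ≤ 2d` — at most `2d·L^{jd}` bonds of `S` lie in `Bʲ(c₋) ∪ Bʲ(c₊)`
(`B7Prop5FlatOperator.card_bondsIn_le`, `card_boxFinset_K`), each weighted `η^d = L^{−jd}`. [cite: Balaban1985Averaging, (141)–(142) p.39] -/
theorem sum_kerQdd_le (S : Finset (Site d × Fin d)) (L : ℕ) (hL : 1 ≤ L) (j : ℕ) (z : Site d) (κ : Fin d) :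
    ∑ s : S, kerQdd L j z κ s.1.1 s.1.2 ≤ 2 * d := by
  classical
  have hL0 : (0 : ℝ) < L := by exact_mod_cast hL
  have hw : (0 : ℝ) ≤ (((L : ℝ) ^ j) ^ d)⁻¹ := by positivity
  set T := bondsIn (loK L j z) (bondHiK L j z κ) with hT
  have hle : ∀ p ∈ S, kerQdd L j z κ p.1 p.2 ≤ if p ∈ T then (((L : ℝ) ^ j) ^ d)⁻¹ else 0 := by
    intro p _
    by_cases h : BondIn (loK L j z) (bondHiK L j z κ) p.1 p.2
    · rw [kerQdd_of_bondIn h, if_pos (mem_bondsIn.2 h)]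
    · rw [kerQdd_of_not_bondIn h]
      split_ifs <;> positivity
  have hcard : (S ∩ T).card ≤ 2 * (L ^ j) ^ d * d :=
    calc (S ∩ T).card ≤ T.card := card_le_card inter_subset_right
      _ ≤ (boxFinset (loK L j z) (bondHiK L j z κ)).card * d := card_bondsIn_le _ _
      _ = 2 * (L ^ j) ^ d * d := by rw [card_boxFinset_K]
  have hcardR : ((S ∩ T).card : ℝ) ≤ ((2 * (L ^ j) ^ d * d : ℕ) : ℝ) := by exact_mod_cast hcard
  calc ∑ s : S, kerQdd L j z κ s.1.1 s.1.2 = ∑ p ∈ S, kerQdd L j z κ p.1 p.2 :=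
        sum_coe_sort S (fun p => kerQdd L j z κ p.1 p.2)
    _ ≤ ∑ p ∈ S, (if p ∈ T then (((L : ℝ) ^ j) ^ d)⁻¹ else 0) := sum_le_sum hle
    _ = ((S ∩ T).card : ℝ) * (((L : ℝ) ^ j) ^ d)⁻¹ := by rw [sum_ite_mem, sum_const, nsmul_eq_mul]
    _ ≤ ((2 * (L ^ j) ^ d * d : ℕ) : ℝ) * (((L : ℝ) ^ j) ^ d)⁻¹ := mul_le_mul_of_nonneg_right hcardR hw
    _ = 2 * d := by
        have hP : ((L : ℝ) ^ j) ^ d ≠ 0 := by positivity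
        push_cast
        field_simp

/-- `Σ_{s∈S} kerQdd(c, s)·‖v_s‖ ≤ 2d·‖v‖` for the sup norm of `𝔸^S` («|Q″_j|δA|| ≦ 2d|δA|», the count of (141)/(142)).
[cite: Balaban1985Averaging, (141)–(142) p.39] -/
theorem sum_kerQdd_mul_norm_le (S : Finset (Site d × Fin d)) (L : ℕ) (hL : 1 ≤ L) (j : ℕ) (z : Site d) (κ : Fin d)
    (v : S → 𝔸) : ∑ s : S, kerQdd L j z κ s.1.1 s.1.2 * ‖v s‖ ≤ 2 * d * ‖v‖ :=
  calc ∑ s : S, kerQdd L j z κ s.1.1 s.1.2 * ‖v s‖ ≤ ∑ s : S, kerQdd L j z κ s.1.1 s.1.2 * ‖v‖ :=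
        sum_le_sum fun s _ => mul_le_mul_of_nonneg_left (norm_le_pi_norm v s) (kerQdd_nonneg L j z κ _ _)
    _ = (∑ s : S, kerQdd L j z κ s.1.1 s.1.2) * ‖v‖ := by rw [sum_mul]
    _ ≤ 2 * d * ‖v‖ := mul_le_mul_of_nonneg_right (sum_kerQdd_le S L hL j z κ) (norm_nonneg v)

end Count

section Regime

variable {𝔸 : Type*} [NormedRing 𝔸] [NormedAlgebra ℂ 𝔸] [CompleteSpace 𝔸] [NormOneClass 𝔸]

variable (L : ℕ) (hL : 2 ≤ L) {G : Subgroup 𝔸ˣ} (hG : AvgClosed d L G) (k : ℕ)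
  (U₀ : Site d → Fin d → 𝔸ˣ) (hU₀ : ∀ x κ, U₀ x κ ∈ G) {α₀ : ℝ} (hα : 0 < α₀)
  (hα3 : C0 d * α₀ ≤ 1 / 3) (hα4 : 4 * α₀ ≤ c2' d L) (h52 : pdev U₀ < α₀ * (((L : ℝ) ^ k)⁻¹) ^ 2)
  {b : ℝ} (hb : 0 < b)
  (hsmall : Real.exp (4 * (800 * ((d : ℝ) + 1) ^ 2 * ((d : ℝ) + 4)) * α₀)
    * (1 + 8 * (131072 * ((d : ℝ) + 1) ^ 2) * ((L : ℝ) ^ k * b)) ≤ 2)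
  (hc₃ : 4 * ((L : ℝ) ^ k * b) < c3 d L)
  (h145 : 8 * d * thetaGen d L α₀ * (L : ℝ)⁻¹ ^ 4 ≤ 1)
  (h155 : (2 * (L : ℝ) - 1) * (L : ℝ)⁻¹ ^ 2 + 2 * d * thetaGen d L α₀ * (L : ℝ)⁻¹ ^ 3
    + 1 / 8 * (1 + 2 * d * thetaGen d L α₀ * (L : ℝ)⁻¹ ^ 2 + 2 * d * C3Gen d L * ((L : ℝ) ^ k * b)) * (L : ℝ)⁻¹ ^ 2 ≤ 1)
  (S : Finset (Site d × Fin d)) {a : S → 𝔸} (ha : ∀ s, ‖a s‖ ≤ b)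

omit [NormedAlgebra ℂ 𝔸] [CompleteSpace 𝔸] [NormOneClass 𝔸] in
include hL hα h52 hb hsmall hc₃ in
/-- the regime at the level `j ≤ k`: (52) `pdev U₀ < α₀L^{−2j}`, and Prop. 4's smallness with `Lʲb ≤ Lᵏb`.
[cite: Balaban1985Averaging, p.37 (after (127)), (52) p.26] -/
private theorem regime_level {j : ℕ} (hj : j ≤ k) :
    pdev U₀ < α₀ * (((L : ℝ) ^ j)⁻¹) ^ 2 ∧
      Real.exp (4 * (800 * ((d : ℝ) + 1) ^ 2 * ((d : ℝ) + 4)) * α₀)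
          * (1 + 8 * (131072 * ((d : ℝ) + 1) ^ 2) * ((L : ℝ) ^ j * b)) ≤ 2 ∧
      2 * ((L : ℝ) ^ j * b) ≤ c3 d L := by
  have hL1r : (1 : ℝ) ≤ L := by exact_mod_cast le_trans (by norm_num) hL
  have hLj : (0 : ℝ) < (L : ℝ) ^ j := by positivity
  have hLk : (0 : ℝ) < (L : ℝ) ^ k := by positivity
  have hjk : (L : ℝ) ^ j ≤ (L : ℝ) ^ k := pow_le_pow_right₀ hL1r hj
  have hinv : ((L : ℝ) ^ k)⁻¹ ≤ ((L : ℝ) ^ j)⁻¹ := by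
    rw [inv_le_inv₀ hLk hLj]; exact hjk
  have h1 : α₀ * (((L : ℝ) ^ k)⁻¹) ^ 2 ≤ α₀ * (((L : ℝ) ^ j)⁻¹) ^ 2 :=
    mul_le_mul_of_nonneg_left (pow_le_pow_left₀ (by positivity) hinv 2) hα.le
  have hjb : (L : ℝ) ^ j * b ≤ (L : ℝ) ^ k * b := mul_le_mul_of_nonneg_right hjk hb.le
  have hLkb : 0 ≤ (L : ℝ) ^ k * b := by positivity
  have h2 : Real.exp (4 * (800 * ((d : ℝ) + 1) ^ 2 * ((d : ℝ) + 4)) * α₀)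
        * (1 + 8 * (131072 * ((d : ℝ) + 1) ^ 2) * ((L : ℝ) ^ j * b))
      ≤ Real.exp (4 * (800 * ((d : ℝ) + 1) ^ 2 * ((d : ℝ) + 4)) * α₀)
        * (1 + 8 * (131072 * ((d : ℝ) + 1) ^ 2) * ((L : ℝ) ^ k * b)) :=
    mul_le_mul_of_nonneg_left (by nlinarith) (Real.exp_pos _).le
  exact ⟨h52.trans_le h1, h2.trans hsmall, by linarith⟩

include hL hG hU₀ hα hα3 hα4 h52 hb hsmall hc₃ ha in
/-- **`C_j(U₀, ins_S ·)(c)` IS FRÉCHET DIFFERENTIABLE** at every point of the polydisc `‖a_s‖ ≤ b`, `j ≤ k` — the differential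
(137) is a continuous LINEAR FUNCTIONAL of `δA`: `Q_j(U₀, ins_S ·)(c)` is analytic there (Prop. 4 at a general background,
`B7Prop6GeneralAnalytic.prop4_general_analyticAt`) and `LʲηQ_j(U₀)(ins_S ·)(c)` is a continuous linear form
(`B7Prop4GeneralCk.clm_linCovIter_ins`). [cite: Balaban1985Averaging, (137) p.39, Prop. 4 p.38, (134) p.38] -/
theorem hasFDerivAt_CCovIter_ins {j : ℕ} (hj : j ≤ k) (z : Site d) (κ : Fin d) :
    HasFDerivAt (fun a' : S → 𝔸 => CCovIter L U₀ (insCfg S a') j z κ)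
      (fderiv ℂ (fun a' : S → 𝔸 => CCovIter L U₀ (insCfg S a') j z κ) a) a := by
  have hLkb : 0 ≤ (L : ℝ) ^ k * b := by positivity
  have hc₃' : 2 * ((L : ℝ) ^ k * b) ≤ c3 d L := by linarith
  have hlog : AnalyticAt ℂ (fun a' : S → 𝔸 => logCovIter L U₀ (insCfg S a') j z κ) a :=
    prop4_general_analyticAt L hL hG k U₀ hU₀ hα hα3 hα4 h52 (fun a' : S → 𝔸 => insCfg S a')
      (fun x κ' => analyticAt_insCfg S x κ' a) hb.le (fun x κ' => norm_insCfg_le_of_le hb.le ha x κ') hsmall hc₃' j hj z κ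
  obtain ⟨h52j, hsmallj, hc3j⟩ := regime_level L hL k U₀ hα h52 hb hsmall hc₃ hj
  obtain ⟨Λ, hΛ⟩ := clm_linCovIter_ins S L hL hG j U₀ hU₀ hα hα3 hα4 h52j hb hsmallj hc3j z κ
  have hlin : DifferentiableAt ℂ (fun a' : S → 𝔸 => linCovIter L U₀ (insCfg S a') j z κ) a := by
    have : (fun a' : S → 𝔸 => linCovIter L U₀ (insCfg S a') j z κ) = fun a' => Λ a' := funext fun a' => (hΛ a').symm
    rw [this]; exact Λ.differentiableAt
  have hC : DifferentiableAt ℂ (fun a' : S → 𝔸 => CCovIter L U₀ (insCfg S a') j z κ) a :=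
    hlog.differentiableAt.sub hlin
  exact hC.hasFDerivAt

include hL hG hU₀ hα hα3 hα4 h52 hb hsmall hc₃ h145 h155 ha in
/-- **THE DERIVATIVE ON A SINGLE-BOND DIRECTION IS THE PER-BOND COLUMN**: `D[C_j(U₀, ins_S ·)(c)](a)(X·e_s) = dC_j(ins_S a;
X·δ_s)(c)` (`B7Prop5GeneralInduction.dCov`, the column bounded by `prop5_general_157`) — (138) «the functional derivative coincides
with partial derivatives»: uniqueness of the derivative along the inserted line `ins_S(a + tX·e_s) = ins_S a + t·bump_s X`
(`B7Prop5FlatOperator.insCfg_line`). [cite: Balaban1985Averaging, (137)–(138) p.39] -/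
theorem fderiv_CCovIter_ins_single {j : ℕ} (hj : j ≤ k) (z : Site d) (κ : Fin d) (s : S) (X : 𝔸) :
    fderiv ℂ (fun a' : S → 𝔸 => CCovIter L U₀ (insCfg S a') j z κ) a (Pi.single s X) =
      dCov L U₀ (insCfg S a) (bump s.1.1 s.1.2 X) j z κ := by
  have hB : ∀ x κ', ‖insCfg S a x κ'‖ ≤ b := fun x κ' => norm_insCfg_le_of_le hb.le ha x κ'
  -- the per-bond line derivative of `prop5_general_157` at `B = ins_S a` …
  obtain ⟨hline, -, -⟩ := prop5_general_157 L hL hG k U₀ hU₀ hα hα3 hα4 h52 (insCfg S a) hb.le hB hsmall hc₃ h145 h155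
    s.1.1 s.1.2 X hj z κ
  -- … read inside `𝔸^S` along `t ↦ a + t·X·e_s`
  have hline' : HasLineDerivAt ℂ (fun a' : S → 𝔸 => CCovIter L U₀ (insCfg S a') j z κ)
      (dCov L U₀ (insCfg S a) (bump s.1.1 s.1.2 X) j z κ) a (Pi.single s X) := by
    have h1 : HasDerivAt (fun t : ℂ => CCovIter L U₀ (insCfg S a + t • bump s.1.1 s.1.2 X) j z κ)
        (dCov L U₀ (insCfg S a) (bump s.1.1 s.1.2 X) j z κ) 0 := hline
    show HasDerivAt (fun t : ℂ => CCovIter L U₀ (insCfg S (a + t • (Pi.single s X : S → 𝔸))) j z κ) _ 0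
    refine h1.congr_of_eventuallyEq (Filter.Eventually.of_forall fun t => ?_)
    simp only [insCfg_line]
  -- the Fréchet derivative evaluated on `X·e_s` is a line derivative too; line derivatives are unique
  have hF := (hasFDerivAt_CCovIter_ins L hL hG k U₀ hU₀ hα hα3 hα4 h52 hb hsmall hc₃ S ha hj z κ).hasLineDerivAt
    (Pi.single s X)
  rw [← hF.lineDeriv, hline'.lineDeriv]

include hL hG hU₀ hα hα3 hα4 h52 hb hsmall hc₃ h145 h155 ha in
/-- **(149)/(157) IN THE PRINTED PAIRING FORM, AT A GENERAL BACKGROUND, k-UNIFORM**: for every `j ≤ k`, every bond `c` of the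
`j`-th lattice and EVERY variation `δa ∈ 𝔸^S`, `‖⟨(δ/δA)C_j(U₀, ins_S a), δa⟩(c)‖ ≤ C₃·(Lʲ)²b·Σ_{s∈S} kerQdd(c, s)·‖δa_s‖` —
«|⟨(δ/δA)C_j(U₀, A), δA⟩| ≦ C₃|A|Q″_j|δA|» with `Q″_j|δA|(c) = Σ_{b⊂Bʲ(c₋)∪Bʲ(c₊)} L^{−jd}|δA_b|` (`kerQdd`) and `C₃ = C3Gen d L`:
the derivative is linear, `δa = Σ_s δa_s·e_s`, and each column is bounded by `prop5_general_157` (zero off the box).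
[cite: Balaban1985Averaging, (149) p.40, (157) p.42, (137)–(138) p.39] -/
theorem ineq149_pairing {j : ℕ} (hj : j ≤ k) (z : Site d) (κ : Fin d) (δa : S → 𝔸) :
    HasFDerivAt (fun a' : S → 𝔸 => CCovIter L U₀ (insCfg S a') j z κ)
        (fderiv ℂ (fun a' : S → 𝔸 => CCovIter L U₀ (insCfg S a') j z κ) a) a ∧
      ‖fderiv ℂ (fun a' : S → 𝔸 => CCovIter L U₀ (insCfg S a') j z κ) a δa‖ ≤
        C3Gen d L * (((L : ℝ) ^ j) ^ 2 * b) * ∑ s : S, kerQdd L j z κ s.1.1 s.1.2 * ‖δa s‖ := by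
  classical
  refine ⟨hasFDerivAt_CCovIter_ins L hL hG k U₀ hU₀ hα hα3 hα4 h52 hb hsmall hc₃ S ha hj z κ, ?_⟩
  set Λ := fderiv ℂ (fun a' : S → 𝔸 => CCovIter L U₀ (insCfg S a') j z κ) a with hΛ
  have hB : ∀ x κ', ‖insCfg S a x κ'‖ ≤ b := fun x κ' => norm_insCfg_le_of_le hb.le ha x κ'
  -- `δa = Σ_s δa_s·e_s` and linearity
  have hsum : Λ δa = ∑ s : S, Λ (Pi.single s (δa s)) := by
    conv_lhs => rw [← Finset.univ_sum_single δa]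
    rw [map_sum]
  -- each column
  have hcol : ∀ s : S, ‖Λ (Pi.single s (δa s))‖ ≤
      C3Gen d L * (((L : ℝ) ^ j) ^ 2 * b) * (kerQdd L j z κ s.1.1 s.1.2 * ‖δa s‖) := by
    intro s
    rw [hΛ, fderiv_CCovIter_ins_single L hL hG k U₀ hU₀ hα hα3 hα4 h52 hb hsmall hc₃ h145 h155 S ha hj z κ s (δa s)]
    obtain ⟨-, hbd, hloc⟩ := prop5_general_157 L hL hG k U₀ hU₀ hα hα3 hα4 h52 (insCfg S a) hb.le hB hsmall hc₃ h145 h155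
      s.1.1 s.1.2 (δa s) hj z κ
    by_cases hin : BondIn (loK L j z) (bondHiK L j z κ) s.1.1 s.1.2
    · rw [kerQdd_of_bondIn hin]
      refine hbd.trans (le_of_eq ?_)
      ring
    · simp only [hloc hin, kerQdd_of_not_bondIn hin, norm_zero, zero_mul, mul_zero, le_refl]
  calc ‖Λ δa‖ = ‖∑ s : S, Λ (Pi.single s (δa s))‖ := by rw [hsum]
    _ ≤ ∑ s : S, ‖Λ (Pi.single s (δa s))‖ := norm_sum_le _ _
    _ ≤ ∑ s : S, C3Gen d L * (((L : ℝ) ^ j) ^ 2 * b) * (kerQdd L j z κ s.1.1 s.1.2 * ‖δa s‖) := sum_le_sum fun s _ => hcol s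
    _ = C3Gen d L * (((L : ℝ) ^ j) ^ 2 * b) * ∑ s : S, kerQdd L j z κ s.1.1 s.1.2 * ‖δa s‖ := by rw [Finset.mul_sum]

include hL hG hU₀ hα hα3 hα4 h52 hb hsmall hc₃ h145 h155 ha in
/-- (149)/(157) in the pairing form, DISPLAYED with the differential (137) `⟨δF/δA, δA⟩ = (d/dt)F(A + tδA)|_{t=0}` (`B7Ineq148.dPair`):
`‖dC_j(U₀, ins_S a; ins_S δa)(c)‖ ≤ C₃·(Lʲ)²b·Σ_{s∈S} kerQdd(c, s)·‖δa_s‖`. [cite: Balaban1985Averaging, (149) p.40, (137) p.39] -/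
theorem ineq149_pairing_dPair {j : ℕ} (hj : j ≤ k) (z : Site d) (κ : Fin d) (δa : S → 𝔸) :
    ‖dPair (fun a' : S → 𝔸 => CCovIter L U₀ (insCfg S a') j z κ) a δa‖ ≤
      C3Gen d L * (((L : ℝ) ^ j) ^ 2 * b) * ∑ s : S, kerQdd L j z κ s.1.1 s.1.2 * ‖δa s‖ := by
  obtain ⟨hF, hbd⟩ := ineq149_pairing L hL hG k U₀ hU₀ hα hα3 hα4 h52 hb hsmall hc₃ h145 h155 S ha hj z κ δa
  rwa [dPair_eq_fderiv hF.differentiableAt]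

include hL hG hU₀ hα hα3 hα4 h52 hb hsmall hc₃ h145 h155 ha in
/-- **(149)/(157) AS AN OPERATOR BOUND** on the linear functional `D[C_j(U₀, ins_S ·)(c)](a) : 𝔸^S → 𝔸` (sup norm on `𝔸^S`):
`‖D[C_j(U₀, ins_S ·)(c)](a)‖ ≤ 2d·C₃·(Lʲ)²b` — (149) with the count `Σ_s kerQdd(c, s) ≤ 2d` of (141)/(142) (`sum_kerQdd_le`); the
general-background counterpart, for the remainder `C_j`, of `B7Prop5FlatOperator.opNorm_fderiv_avgMap_le`'s `C₃`-term.
[cite: Balaban1985Averaging, (149) p.40, (157) p.42, (141)–(142) p.39] -/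
theorem opNorm_fderiv_CCovIter_ins_le {j : ℕ} (hj : j ≤ k) (z : Site d) (κ : Fin d) :
    ‖fderiv ℂ (fun a' : S → 𝔸 => CCovIter L U₀ (insCfg S a') j z κ) a‖ ≤ 2 * d * (C3Gen d L * (((L : ℝ) ^ j) ^ 2 * b)) := by
  have hL1 : 1 ≤ L := le_trans (by norm_num) hL
  have hC := C3Gen_nonneg d L
  have hK : 0 ≤ C3Gen d L * (((L : ℝ) ^ j) ^ 2 * b) := by positivity
  refine ContinuousLinearMap.opNorm_le_bound _ (by positivity) fun v => ?_
  obtain ⟨-, hbd⟩ := ineq149_pairing L hL hG k U₀ hU₀ hα hα3 hα4 h52 hb hsmall hc₃ h145 h155 S ha hj z κ v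
  refine hbd.trans ?_
  calc C3Gen d L * (((L : ℝ) ^ j) ^ 2 * b) * ∑ s : S, kerQdd L j z κ s.1.1 s.1.2 * ‖v s‖
      ≤ C3Gen d L * (((L : ℝ) ^ j) ^ 2 * b) * (2 * d * ‖v‖) :=
        mul_le_mul_of_nonneg_left (sum_kerQdd_mul_norm_le S L hL1 j z κ v) hK
    _ = 2 * d * (C3Gen d L * (((L : ℝ) ^ j) ^ 2 * b)) * ‖v‖ := by ring

end Regime

end Literature.MathematicalPhysics.QuantumFieldTheory.Balaban1983to89.B7Ineq149Pairing

end
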